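import Literature.Geometry.GeometricMeasureTheory.ChartCurrent
import Literature.Geometry.GeometricMeasureTheory.IntegralCurrentsDimZero
import HarnessLib

/-!
# Segment currents: the oriented segment `k ⟦a, b⟧` as a rectifiable `1`-current

For points `a, b` of a finite-dimensional real inner product space `V` and `k ∈ ℤ`, the current
`k ⟦a, b⟧(φ) = k ∫_0^1 φ(a + t (b − a))(b − a) dt` — Federer's "oriented simplex" / associated
polyhedral chain of the segment [Federer1969, 4.1.11 ("`δ_a ⨯ δ_b`", the join of two point masses
is the oriented segment), 4.1.22, 4.1.32] — is a rectifiable `1`-current (`∈ 𝓡_1(V)`, indeed an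
integral polyhedral chain) supported in the segment, of mass `|k| ‖b − a‖`, with boundary
`∂(k ⟦a, b⟧) = k δ_b − k δ_a` (the fundamental theorem of calculus). Here it is realised as the chart
current `[g(Q), k, ξ]` of `ChartCurrent.lean` for the affine chart `g(s) = a + (s − c)(b − a)` of
the open segment (`Q = (c, c+1)`, left inverse `π = ⟪b − a, ·⟫/‖b − a‖²`, `c = π a`), with the
point masses `k δ_x = [{x}, k]` of `IntegralCurrentsDimZero.lean`:

* `addHaarScalarFactor_volume_hausdorffMeasure_one` — the Euclidean normalisation of `μHE[1]` is
  trivial, so `μHE[1](segment a b) = ‖b − a‖` (`euclideanHausdorffMeasure_one_segment`);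
* `currentOfIntegration_singleton_apply` — `[{x}, k](φ) = k φ(x)`;
* **`exists_segmentCurrent`** — for all `k, a, b` there is `S ∈ 𝓡_1(V)` with `spt S ⊆ segment a b`,
  `𝐌(S) ≤ |k| ‖b − a‖` and `∂S = [{b}, k] − [{a}, k]`.

Theorems only; no definitions, no named facts.

## References

* H. Federer, *Geometric Measure Theory*, Grundlehren 153, Springer 1969, 2.10.2, 4.1.8, 4.1.11,
  4.1.22, 4.1.28, 4.1.32 [Federer1969].
-/

noncomputable section

open scoped ENNReal NNReal Topology RealInnerProductSpace
open MeasureTheory MeasureTheory.Measure TopologicalSpace Set Filter Metric Function Module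
  InnerProductSpace

namespace Literature.Geometry.GeometricMeasureTheory

set_option maxSynthPendingDepth 2

/-! ### `μHE[1] = 𝓗^1` -/

section ScalingOne

/-- The Euclidean normalisation constant of `μHE[1]` is `1`: on `ℝ`, `μHE[1] = vol = 𝓗^1`.
[cite: Federer1969, 2.10.2, 2.10.35] -/
theorem addHaarScalarFactor_volume_hausdorffMeasure_one :
    addHaarScalarFactor (volume : Measure (EuclideanSpace ℝ (Fin 1))) μH[((1 : ℕ) : ℝ)] = 1 := by
  have h := InnerProductSpace.euclideanHausdorffMeasure_eq_volume (V := ℝ)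
  rw [Module.finrank_self, euclideanHausdorffMeasure_def] at h
  have h1 := congrArg (fun μ : Measure ℝ => μ (Icc 0 1)) h
  simp only [Measure.smul_apply, Nat.cast_one, hausdorffMeasure_real, Real.volume_Icc, sub_zero,
    ENNReal.ofReal_one, ENNReal.smul_def, smul_eq_mul, mul_one, ENNReal.coe_eq_one] at h1
  simpa using h1

/-- `μHE[1](segment a b) = ‖b − a‖` (`μHE[1] = 𝓗^1`, the general identity being the tree's
`Literature.MathematicalPhysics.QuantumLattice.euclideanHausdorffMeasure_one`, not imported here to
keep the import cone of this file inside `GeometricMeasureTheory`; and `𝓗^1(segment a b) = ‖b − a‖`,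
Mathlib's `hausdorffMeasure_segment`). [cite: Federer1969, 2.10.2] -/
theorem euclideanHausdorffMeasure_one_segment {E : Type*} [NormedAddCommGroup E] [NormedSpace ℝ E]
    [MeasurableSpace E] [BorelSpace E] (a b : E) :
    (μHE[1] : Measure E) (segment ℝ a b) = ‖b - a‖ₑ := by
  rw [euclideanHausdorffMeasure_def, addHaarScalarFactor_volume_hausdorffMeasure_one, one_smul,
    Nat.cast_one, hausdorffMeasure_segment, edist_comm, edist_eq_enorm_sub]

end ScalingOne

/-! ### Point masses -/

section PointMass

variable {V : Type*} [NormedAddCommGroup V] [InnerProductSpace ℝ V] [MeasurableSpace V]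
  [BorelSpace V] {Ω : Opens V}

/-- `[{x}, k](φ) = k φ(x)` — the point mass `k δ_x`. [cite: Federer1969, 4.1.25, 4.1.28] -/
theorem currentOfIntegration_singleton_apply (x : V) (k : ℤ) (φ : TestForm Ω 0) :
    (currentOfIntegration {x} (fun _ => k) (fun _ => ![]) : Current Ω 0) φ = (k : ℝ) * φ x ![] := by
  rw [← Finset.coe_singleton, currentOfIntegration_finset_apply, Finset.sum_singleton]

end PointMass

/-! ### The segment current -/

section Segment

variable {V : Type*} [NormedAddCommGroup V] [InnerProductSpace ℝ V] [FiniteDimensional ℝ V]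
  [MeasurableSpace V] [BorelSpace V]

/-- **The oriented segment `k ⟦a, b⟧` is a rectifiable `1`-current with boundary `k δ_b − k δ_a`.**
For every `k ∈ ℤ` and `a, b ∈ V` there is `S ∈ 𝓡_1(V)` with `spt S ⊆ segment a b`,
`𝐌(S) ≤ |k| ‖b − a‖` and `∂S = [{b}, k] − [{a}, k]` (for `a = b`, `S = 0`; otherwise `S` is the chart
current of the affine parametrisation of the open segment, and the boundary formula is the
fundamental theorem of calculus). [cite: Federer1969, 4.1.8, 4.1.11, 4.1.32] -/
theorem exists_segmentCurrent (k : ℤ) (a b : V) :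
    ∃ S : Current (⊤ : Opens V) 1, S.IsRectifiable ∧ S.support ⊆ segment ℝ a b ∧
      S.mass ≤ ‖(k : ℝ)‖ₑ * ‖b - a‖ₑ ∧
      S.boundary = (currentOfIntegration {b} (fun _ => k) (fun _ => ![]) : Current (⊤ : Opens V) 0) -
        currentOfIntegration {a} (fun _ => k) (fun _ => ![]) := by
  by_cases hab : a = b
  · subst hab
    exact ⟨0, Current.isRectifiable_zero, by simp, by simp, by rw [Current.boundary_zero, sub_self]⟩
  -- the affine chart of the open segment
  set w : V := b - a with hw
  have hw0 : w ≠ 0 := fun h => hab (eq_of_sub_eq_zero h).symm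
  have hwn : 0 < ‖w‖ := norm_pos_iff.2 hw0
  set π : V →L[ℝ] ℝ := (‖w‖ ^ 2)⁻¹ • innerSL ℝ w with hπ
  have hπapply : ∀ y, π y = (‖w‖ ^ 2)⁻¹ * ⟪w, y⟫ := fun y => by
    simp [hπ, innerSL_apply_apply]
  have hπw : π w = 1 := by
    rw [hπapply, real_inner_self_eq_norm_sq, inv_mul_cancel₀ (pow_ne_zero 2 hwn.ne')]
  set c : ℝ := π a with hc
  set g : ℝ → V := fun s => a + (s - c) • w with hg
  have hπg : ∀ s, π (g s) = s := fun s => by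
    simp only [hg, map_add, map_smul, smul_eq_mul, hπw, mul_one, ← hc]; ring
  have hgc : g c = a := by simp [hg]
  have hgc1 : g (c + 1) = b := by simp [hg, hw]
  have hgs : ContDiff ℝ 1 g := by
    simp only [hg]; fun_prop
  have hderiv : ∀ s, HasDerivAt g w s := fun s => by
    have := ((hasDerivAt_id s).sub_const c).smul_const w
    simpa [hg] using this.const_add a
  have hfd : ∀ s, fderiv ℝ g s = (1 : ℝ →L[ℝ] ℝ).smulRight w := fun s => (hderiv s).hasFDerivAt.fderiv
  have hfdap : ∀ s r, fderiv ℝ g s r = r • w := fun s r => by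
    rw [hfd s]; rfl
  have hC : ∀ s ∈ Ioo c (c + 1), ‖fderiv ℝ g s‖ ≤ ‖w‖ := fun s _ => by
    rw [hfd s, ContinuousLinearMap.norm_smulRight_apply, norm_one, one_mul]
  -- the frame
  set e : OrthonormalBasis (Fin 1) ℝ ℝ := OrthonormalBasis.singleton (Fin 1) ℝ with he
  have heapp : ∀ j, e j = 1 := fun j => OrthonormalBasis.singleton_apply (ι := Fin 1) (𝕜 := ℝ) j
  have hframe : ∀ s, (fun j : Fin 1 => fderiv ℝ g s (e j)) = fun _ => w := fun s => by
    funext j; rw [heapp, hfdap, one_smul]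
  set ξ : V → Fin 1 → V := fun _ => gramSchmidtNormed ℝ fun _ : Fin 1 => w with hξ
  have hξg : ∀ s ∈ Ioo c (c + 1), ξ (g s) = gramSchmidtNormed ℝ fun j => fderiv ℝ g s (e j) :=
    fun s _ => by rw [hframe s]
  have hlin : LinearIndependent ℝ fun _ : Fin 1 => w := linearIndependent_unique_iff.2 hw0
  have horth : Orthonormal ℝ (gramSchmidtNormed ℝ fun _ : Fin 1 => w) :=
    gramSchmidtNormed_orthonormal hlin
  -- the image is the open segment
  have hQ : IsOpen (Ioo c (c + 1)) := isOpen_Ioo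
  have hQb : Bornology.IsBounded (Ioo c (c + 1)) := isBounded_Ioo c (c + 1)
  have hseg : g '' Ioo c (c + 1) ⊆ segment ℝ a b := by
    rintro _ ⟨s, hs, rfl⟩
    rw [segment_eq_image']
    exact ⟨s - c, ⟨by linarith [hs.1], by linarith [hs.2]⟩, by simp [hg, hw]⟩
  have hsegc : IsClosed (segment ℝ a b) := by
    rw [segment_eq_image']
    exact (isCompact_Icc.image (by fun_prop)).isClosed
  -- the current
  set S : Current (⊤ : Opens V) 1 := currentOfIntegration (g '' Ioo c (c + 1)) (fun _ => k) ξ with hS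
  refine ⟨S, ?_, ?_, ?_, ?_⟩
  · exact isRectifiable_currentOfIntegration_image e hgs (fun s _ => hπg s) hQ hQb hC
      (Ω := (⊤ : Opens V)) (fun _ _ => trivial) hξg k
  · exact (support_currentOfIntegration_subset_closure _ _ _).trans (hsegc.closure_subset_iff.2 hseg)
  · refine (mass_currentOfIntegration_le _ _ _ (Eventually.of_forall fun x =>
      norm_frameVector_le_one horth)).trans ?_
    rw [lintegral_const, Measure.restrict_apply MeasurableSet.univ, univ_inter]
    exact mul_le_mul' le_rfl ((measure_mono hseg).trans (euclideanHausdorffMeasure_one_segment a b).le)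
  · -- the boundary: fundamental theorem of calculus along the chart
    ext ψ
    rw [Current.boundary_apply, _root_.sub_apply, currentOfIntegration_singleton_apply,
      currentOfIntegration_singleton_apply, ← mul_sub, hS,
      currentOfIntegration_image_apply_of_leftInverse e hgs (fun s _ => hπg s) hQ hQb hC hξg k]
    congr 1
    -- `F = ψ(·)(∅)` and `(F ∘ g)' = dψ(g s)(w)`
    set F : V → ℝ := fun y => ψ y ![] with hF
    have hFd : ∀ y, HasFDerivAt F (fderiv ℝ F y) y := fun y => by
      have : ContDiff ℝ 1 F := by
        simp only [hF]
        exact (ContinuousAlternatingMap.apply ℝ V ℝ ![]).contDiff.comp (ψ.contDiff.of_le (WithTop.coe_le_coe.2 le_top))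
      exact (this.differentiable one_ne_zero y).hasFDerivAt
    have hint : ∀ s, (TestForm.extDerivCLM ψ) (g s) (fun j => fderiv ℝ g s (e j)) =
        fderiv ℝ F (g s) w := by
      intro s
      rw [hframe s, TestForm.extDerivCLM_apply,
        extDeriv_apply ((ψ.contDiff.differentiable (by simp)).differentiableAt)]
      rw [Fin.sum_univ_one, Fin.val_zero, pow_zero, one_smul]
      have : (fun y => ψ y (Fin.removeNth 0 fun _ : Fin 1 => w)) = F := by
        funext y; simp only [hF]; congr 1; exact Subsingleton.elim _ _
      rw [this]
    simp_rw [hint]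
    have hFg : ∀ s, HasDerivAt (F ∘ g) (fderiv ℝ F (g s) w) s := fun s =>
      (hFd (g s)).comp_hasDerivAt s (hderiv s)
    have hcont : Continuous fun s => fderiv ℝ F (g s) w := by
      have h1 : ContDiff ℝ 1 (F ∘ g) := by
        have : ContDiff ℝ 1 F := by
          simp only [hF]
          exact (ContinuousAlternatingMap.apply ℝ V ℝ ![]).contDiff.comp (ψ.contDiff.of_le (WithTop.coe_le_coe.2 le_top))
        exact this.comp hgs
      have h2 : deriv (F ∘ g) = fun s => fderiv ℝ F (g s) w := funext fun s => (hFg s).deriv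
      rw [← h2]
      exact h1.continuous_deriv le_rfl
    rw [← integral_Ioc_eq_integral_Ioo, ← intervalIntegral.integral_of_le (by linarith),
      intervalIntegral.integral_eq_sub_of_hasDerivAt (fun s _ => hFg s)
        (hcont.intervalIntegrable _ _)]
    simp only [Function.comp_apply, hgc, hgc1, hF]

end Segment

end Literature.Geometry.GeometricMeasureTheory
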